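import Literature.MathematicalPhysics.QuantumFieldTheory.Balaban1983to89.B9Eq3126GreenLetters
import Literature.MathematicalPhysics.QuantumFieldTheory.Balaban1983to89.B9Eq365QGGQLowerVariational

/-!
# `Balaban1983to89.B9Eq3126GreenLettersVariational` — T. Bałaban, *Propagators for lattice gauge theories in a background field*, Commun. Math.
# Phys. **99** (1985) 389–434 [Balaban1985BackgroundPropagators] (3.126) p. 420 *«HB = GQ*(QGQ*)⁻¹B»* with Thm 3.11 p. 416, and [Balaban1985Variational]
# (45) p. 285 *«H … giving a minimum of the quadratic form ½⟨A, ΔA⟩ under the restrictions L^jηQ_jA = B»*: **THE VARIATIONAL CURRENCY FOR THE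
# LETTERS `(QG₁Q†)⁻¹` AND `H₁ = G₁Q†(QG₁Q†)⁻¹` — OPERATOR BOUNDS FROM THE COERCIVITY CONSTANT `γ` OF `Δ_a` AND THE ENERGY OF ONE TEST FAMILY,
# WITH NO OPERATOR BOUND OF `Δ_a`** (abstract finite-dimensional `𝕜`-Hilbert letters for the pub-balaban NE9 chain's `B11Eq103H1Complex.KinvK`/`H1K`)

statement-level skeleton of published theorems with citation tags; proofs where landed; nothing here is a claim about the Yang–Mills mass gap

CITATION HEADER (lean-in-tree rule).  Audit cell `pub-balaban`, sub-cell `t4`, BINDER row NE9; filed by NE9 formalisation-swarm LEAF PROVER 02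
(`b2b-balaban-t4-ne9-formalise-leaf-02`, gen 65).  Sources READ in the held text layers: [Balaban1985BackgroundPropagators]
(`paper:balaban1985-cmp99-background-propagators`, journal page = PDF page + 388) p. 416 Thm 3.11, p. 420 (3.126); [Balaban1985Variational]
(`paper:balaban1985-cmp102-variational-background`, journal page = PDF page + 276) p. 285 (45)–(46), p. 297 (129) (via the tree's render-verified
transcripts quoted in `B11Eq129Minimizer` / `B11Eq103H1Complex`).

THE PRINT (verbatim).  [B11] p. 285: *«The operators Δ, Q and R define the operator H. Let us recall that it is an operator defined on configurations B
and giving a minimum of the quadratic form ½⟨A, ΔA⟩ under the restrictions L^jηQ_jA = B on Λ_j, j = 0, 1, …, k, RD*A = 0. Thus it has the following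
properties L^jηQ_jHB = B on Λ_j, RD*HB = 0, (45) and the Theorem 3.12 from [5] implies |HB| ≤ B₀(L^jη)^{−1}|B| … (46)»*; p. 297 (129): *«H₀B is defined
as a minimum of the quadratic form ½⟨A′, Δ_aA′⟩ on the subspace L^{j(·)}ηQA′ = B. We find easily that H₀B is given by H₀B = GQ*(QGQ*)⁻¹(L^{j(·)}η)⁻¹B»*.
[B9] p. 420, (3.126): *«HB = GQ*(QGQ*)⁻¹B»*; p. 416, Thm 3.11: *«the operators Δ′_a, G′, (Q′G′²Q′*)⁻¹, Δ_a, G are positive definite»*.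

WHY THIS FILE (cell context).  The chain's operator letters for `(QG₁Q†)⁻¹` and `H₁` (`B9Eq3126GreenLetters.norm_KinvK_le` ∕ `norm_H1K_le`, owner
t4-ne9-p1 gen 80) are `‖(QG₁Q†)⁻¹‖ ≤ M²∕(γμ_Q²)` and `‖H₁‖ ≤ γ⁻¹M_Q·M²∕(γμ_Q²)`, with `M` an OPERATOR bound of `Δ_a` — on the fine lattice `M ∝ |η|⁻²`
(`B9Eq3126H1BoundTower.norm_laplaceAk_le`: `64d|η|⁻² + …`), so the `k`-level constants `C_H`, `C_K` of `B9Eq3126H1BoundTower` §3 grow like `|η|⁻⁴ = L^{4(n+1)}`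
on print's diagonal — the `H`-analogue of the `R`-letter obstruction removed by the owner's TOWER-R-PROGRAMME (g85).  Print's `H` is the MINIMISER (45)∕(129):
its size is governed by the coercivity constant `γ` and by the ENERGY `re⟨u, Δ_a u⟩` of any admissible comparison configuration, never by `‖Δ_a‖`.  This file
is that currency, abstractly: every bound below is `M`-free.  The one displayed letter left — a test family `u_y` with `β‖y‖² ≤ re⟨Qu_y, y⟩` and
`re⟨u_y, Δ_a u_y⟩ ≤ M_u‖y‖²` (or a right inverse `S` of `Q` with `re⟨Sy, Δ_a Sy⟩ ≤ C_S‖y‖²`) — is a FORM quantity of a smooth comparison field, the object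
print bounds; its level-free instance at the flat background is the sequel's (bond analogue of ne9-leaf-01's `B9Eq319BlockTentLift` ∕ `B9Eq365QGGQLowerVariational`,
whose abstract first-order variational principle `sq_div_mul_le_re_inner_green` is used here BY NAME).

WHAT IS PROVED (sorry-free; 0 `def`; [folklore] finite-dimensional Hilbert-space algebra; nothing of [B9]∕[B11] asserted as printed).  Letters as in
`B9Eq3126GreenLetters` §1: `T := laplaceAK Δ D R D* Q Q† a` with displayed positivity `hpos`, `K := QG₁Q†`, `K⁻¹ := KinvK`, `H₁ := H1K`.
* §1 (no symmetry, no coercivity) **`inner_H1K_laplaceAK_H1K`** — `⟪H₁b, Δ_a H₁b⟫ = ⟪b, K⁻¹b⟫` (the minimiser's energy IS the `K⁻¹`-form);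
  **`re_inner_KinvK_nonneg`**.
* §2 (coercivity `γ‖x‖² ≤ re⟪x, Δ_a x⟫`) **`norm_H1K_sq_le`** — `‖H₁b‖² ≤ γ⁻¹·re⟪b, K⁻¹b⟫ ≤ γ⁻¹‖b‖‖K⁻¹b‖`; **`norm_H1K_le_of_KinvK`** — a bound
  `‖K⁻¹y‖ ≤ C_K‖y‖` gives `‖H₁b‖ ≤ √(C_K∕γ)·‖b‖`.
* §3 (`Δ_a` symmetric — in the chain: `hRS` + symmetric `Δ₁`, `R`, `B11Eq103H1Complex.laplaceALatticeK_isSymmetric`) **`re_inner_K_ge_of_test`** — a TEST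
  FAMILY `u : F → E` with `β‖y‖² ≤ re⟪Q(u y), y⟫` and `re⟪u y, Δ_a(u y)⟫ ≤ M_u‖y‖²` (`β ≥ 0`, `M_u > 0`) gives `(β²∕M_u)‖y‖² ≤ re⟪y, Ky⟫`;
  **`norm_KinvK_le_of_test`** (`‖K⁻¹y‖ ≤ (M_u∕β²)‖y‖`, `β > 0`); **`norm_H1K_le_of_test`** (`‖H₁b‖ ≤ √(M_u∕(γβ²))·‖b‖`); the SECTION case `u = S`,
  `QS = 1`, `β = 1`: **`re_inner_K_ge_of_section`**, **`norm_KinvK_le_of_section`** (`≤ C_S‖y‖`), **`norm_H1K_le_of_section`** (`≤ √(C_S∕γ)‖b‖`).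
* §4 (`Δ_a` symmetric) THE MINIMISER, complex twin of lit-balaban's real `B11Eq129Minimizer.isMinOn_hOp` for the chain's OWN `H1K`:
  **`re_inner_laplaceAK_H1K_add`** (energy splitting `re⟪x₀, Δ_a x₀⟫ = re⟪H₁b, Δ_a H₁b⟫ + re⟪x₀ − H₁b, Δ_a(x₀ − H₁b)⟫` on `Qx₀ = b`),
  **`re_inner_laplaceAK_H1K_le`** ((45): `H₁b` minimises the energy on `{Qx₀ = b}`), **`re_inner_KinvK_le_energy`** (`re⟪b, K⁻¹b⟫ ≤ re⟪x₀, Δ_a x₀⟫`),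
  **`norm_H1K_sq_le_energy`** (`‖H₁b‖² ≤ γ⁻¹·re⟪x₀, Δ_a x₀⟫` for EVERY `x₀` with `Qx₀ = b`).
MODEL ∕ HONEST SCOPE.  (M1) `E`, `F` finite-dimensional `𝕜`-Hilbert spaces, `S` a `𝕜`-inner-product space; `Q* := Q†`.  (M2) displayed: `hpos`; in §2 the
coercivity constant `γ`; in §3–§4 the symmetry of `Δ_a`; in §3 the test family ∕ section and ITS two numbers.  (M3) crude bookkeeping; no decay; `𝔊 = G₁𝔓*`
is NOT treated (its `DRD*G₁` term carries `‖D‖ ∝ |η|⁻¹` in the operator currency — a separate question).  NOT summit progress (cell pub-balaban: NE9 NOT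
PRINTED ∕ NOT PROVED; «NE9 ⇐ the named binders»; row WALLED ON A MODEL (O-NE9-1; #5 UNRULED); spine PROVED 0∕9; rung (B)+1 finite T⁴ — NOT infinite volume,
NOT mass gap, NOT BetaPertH, NOT Clay).  HONEST DEPENDENCY (cell line): continuum YM on T⁴ ⇐ BetaPertH ∧ nine spine estimates (0/9 proved); BetaPertH ⇐ (D1) ∧
(D4) ∧ CAP+tail; G-an2-4 gates asym, D1 and NE2/3/4.  NEW file importing `B9Eq3126GreenLetters` (owner g80) and `B9Eq365QGGQLowerVariational` (ne9-leaf-01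
g78, for `sq_div_mul_le_re_inner_green`); nothing modified.  Net new unproved facts: 0.
-/

noncomputable section

open scoped InnerProductSpace ComplexConjugate BigOperators

namespace Literature.MathematicalPhysics.QuantumFieldTheory.Balaban1983to89.B9Eq3126GreenLettersVariational

open B11Eq103H1Complex (laplaceAK greenK apply_greenK greenK_apply G1K KinvK H1K laplaceAK_G1K laplaceAK_H1K Q_H1K hKK_holds
  inner_laplaceAK_H1K_eq_zero)
open B9Eq3126GreenLetters (norm_greenK_le)
open B9Eq365QGGQLowerVariational (sq_div_mul_le_re_inner_green)

section Abstract

variable {𝕜 : Type*} [RCLike 𝕜] {E : Type*} [NormedAddCommGroup E] [InnerProductSpace 𝕜 E] [FiniteDimensional 𝕜 E]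
  {F : Type*} [NormedAddCommGroup F] [InnerProductSpace 𝕜 F] [FiniteDimensional 𝕜 F] {S : Type*} [NormedAddCommGroup S] [InnerProductSpace 𝕜 S]
  {Δ : E →ₗ[𝕜] E} {D : S →ₗ[𝕜] E} {R : S →ₗ[𝕜] S} {Dstar : E →ₗ[𝕜] S} {Q : E →ₗ[𝕜] F} {a : 𝕜}
  (hpos : ∀ x : E, x ≠ 0 → 0 < RCLike.re ⟪x, laplaceAK Δ D R Dstar Q (LinearMap.adjoint Q) a x⟫_𝕜)
  (hadj : ∀ (x : E) (y : F), ⟪Q x, y⟫_𝕜 = ⟪x, LinearMap.adjoint Q y⟫_𝕜) (hinj : Function.Injective (LinearMap.adjoint Q))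

/-! ## §1 The minimiser's energy is the `(QG₁Q†)⁻¹`-form -/

/-- **`⟪H₁b, Δ_a H₁b⟫ = ⟪b, (QG₁Q†)⁻¹b⟫`** — `Δ_a H₁b = Q†(QG₁Q†)⁻¹b` and `QH₁b = b` ((45)∕(129)): the energy of the minimiser is the form of `K⁻¹`.
[folklore] [cite: Balaban1985Variational, (45) p.285, (129) p.297; Balaban1985BackgroundPropagators, (3.126) p.420] -/
theorem inner_H1K_laplaceAK_H1K (b : F) :
    ⟪H1K hpos hadj hinj b, laplaceAK Δ D R Dstar Q (LinearMap.adjoint Q) a (H1K hpos hadj hinj b)⟫_𝕜 = ⟪b, KinvK hpos hadj hinj b⟫_𝕜 := by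
  rw [laplaceAK_H1K, ← hadj, Q_H1K]

/-- `re⟪H₁b, Δ_a H₁b⟫ = re⟪b, K⁻¹b⟫` (real parts). [folklore] [cite: Balaban1985Variational, (45) p.285, (129) p.297] -/
theorem re_inner_H1K_laplaceAK_H1K (b : F) :
    RCLike.re ⟪H1K hpos hadj hinj b, laplaceAK Δ D R Dstar Q (LinearMap.adjoint Q) a (H1K hpos hadj hinj b)⟫_𝕜 =
      RCLike.re ⟪b, KinvK hpos hadj hinj b⟫_𝕜 := by
  rw [inner_H1K_laplaceAK_H1K]

/-- `0 ≤ re⟪b, (QG₁Q†)⁻¹b⟫` — the `K⁻¹`-form is an energy (the displayed positivity of `Δ_a` at `H₁b`). [folklore]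
[cite: Balaban1985BackgroundPropagators, Thm 3.11 p.416] -/
theorem re_inner_KinvK_nonneg (b : F) : 0 ≤ RCLike.re ⟪b, KinvK hpos hadj hinj b⟫_𝕜 := by
  rw [← re_inner_H1K_laplaceAK_H1K hpos hadj hinj]
  by_cases h : H1K hpos hadj hinj b = 0
  · rw [h, inner_zero_left, map_zero]
  · exact (hpos _ h).le

/-! ## §2 Coercivity: `‖H₁b‖² ≤ γ⁻¹·re⟪b, K⁻¹b⟫` — no operator bound of `Δ_a` -/

variable {γ : ℝ} (hγ : 0 < γ) (hcoer : ∀ x : E, γ * ‖x‖ ^ 2 ≤ RCLike.re ⟪x, laplaceAK Δ D R Dstar Q (LinearMap.adjoint Q) a x⟫_𝕜)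

include hγ hcoer in
/-- **`‖H₁b‖² ≤ γ⁻¹·re⟪b, (QG₁Q†)⁻¹b⟫`** for a `γ`-coercive `Δ_a` (`γ‖H₁b‖² ≤ re⟪H₁b, Δ_a H₁b⟫ = re⟪b, K⁻¹b⟫`). [folklore]
[cite: Balaban1985Variational, (45)–(46) p.285; Balaban1985BackgroundPropagators, Thm 3.11 p.416, (3.126) p.420] -/
theorem norm_H1K_sq_le (b : F) : ‖H1K hpos hadj hinj b‖ ^ 2 ≤ γ⁻¹ * RCLike.re ⟪b, KinvK hpos hadj hinj b⟫_𝕜 := by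
  have h := hcoer (H1K hpos hadj hinj b)
  rw [re_inner_H1K_laplaceAK_H1K] at h
  rw [inv_mul_eq_div, le_div_iff₀' hγ]
  exact h

include hγ hcoer in
/-- `‖H₁b‖² ≤ γ⁻¹·‖b‖·‖(QG₁Q†)⁻¹b‖` (Cauchy–Schwarz on the previous). [folklore] [cite: Balaban1985Variational, (45)–(46) p.285] -/
theorem norm_H1K_sq_le' (b : F) : ‖H1K hpos hadj hinj b‖ ^ 2 ≤ γ⁻¹ * (‖b‖ * ‖KinvK hpos hadj hinj b‖) :=
  (norm_H1K_sq_le hpos hadj hinj hγ hcoer b).trans (mul_le_mul_of_nonneg_left (re_inner_le_norm _ _) (inv_nonneg.2 hγ.le))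

include hγ hcoer in
/-- **A BOUND OF `(QG₁Q†)⁻¹` GIVES ONE OF `H₁`, `M`-FREE**: `‖K⁻¹y‖ ≤ C_K‖y‖` for all `y` implies `‖H₁b‖ ≤ √(C_K∕γ)·‖b‖`. [folklore]
[cite: Balaban1985Variational, (45)–(46) p.285; Balaban1985BackgroundPropagators, (3.126) p.420] -/
theorem norm_H1K_le_of_KinvK {CK : ℝ} (hCK : 0 ≤ CK) (hK : ∀ y : F, ‖KinvK hpos hadj hinj y‖ ≤ CK * ‖y‖) (b : F) :
    ‖H1K hpos hadj hinj b‖ ≤ Real.sqrt (CK / γ) * ‖b‖ := by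
  have h1 : ‖H1K hpos hadj hinj b‖ ^ 2 ≤ (Real.sqrt (CK / γ) * ‖b‖) ^ 2 := by
    calc ‖H1K hpos hadj hinj b‖ ^ 2 ≤ γ⁻¹ * (‖b‖ * ‖KinvK hpos hadj hinj b‖) := norm_H1K_sq_le' hpos hadj hinj hγ hcoer b
      _ ≤ γ⁻¹ * (‖b‖ * (CK * ‖b‖)) := by gcongr; exact hK b
      _ = CK / γ * ‖b‖ ^ 2 := by ring
      _ = (Real.sqrt (CK / γ) * ‖b‖) ^ 2 := by rw [mul_pow, Real.sq_sqrt (div_nonneg hCK hγ.le)]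
  have h2 := Real.sqrt_le_sqrt h1
  rwa [Real.sqrt_sq (norm_nonneg _), Real.sqrt_sq (by positivity)] at h2

/-! ## §3 The test-family floor of `K = QG₁Q†` (symmetric `Δ_a`): `(β²∕M_u)‖y‖² ≤ re⟪y, Ky⟫` -/

variable (hTs : (laplaceAK Δ D R Dstar Q (LinearMap.adjoint Q) a).IsSymmetric)

include hadj hTs in
/-- **THE TEST-FAMILY FLOOR OF `QG₁Q†`.**  If for every `y` a test vector `u y` has `β‖y‖² ≤ re⟪Q(u y), y⟫` and energy `re⟪u y, Δ_a(u y)⟫ ≤ M_u‖y‖²`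
(`β ≥ 0`, `M_u > 0`), then `(β²∕M_u)‖y‖² ≤ re⟪y, QG₁Q†y⟫` — the first-order variational principle (`B9Eq365QGGQLowerVariational.sq_div_mul_le_re_inner_green`,
the device of [Balaban1984PropagatorsII] (2.74)–(2.77) in the cell's variational form) at `x = Q†y`: only FORMS of the test vector enter, never `‖Δ_a‖`.
[folklore] [cite: Balaban1985BackgroundPropagators, Thm 3.11 p.416, (3.126) p.420; Balaban1984PropagatorsII, (2.74)–(2.77) p.236] -/
theorem re_inner_K_ge_of_test {u : F → E} {β Mu : ℝ} (hMu : 0 < Mu) (hβ : 0 ≤ β)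
    (hux : ∀ y : F, β * ‖y‖ ^ 2 ≤ RCLike.re ⟪Q (u y), y⟫_𝕜)
    (huu : ∀ y : F, RCLike.re ⟪u y, laplaceAK Δ D R Dstar Q (LinearMap.adjoint Q) a (u y)⟫_𝕜 ≤ Mu * ‖y‖ ^ 2) (y : F) :
    β ^ 2 / Mu * ‖y‖ ^ 2 ≤ RCLike.re ⟪y, (Q ∘ₗ G1K Δ D R Dstar Q (LinearMap.adjoint Q) a hpos ∘ₗ LinearMap.adjoint Q) y⟫_𝕜 := by
  rw [LinearMap.comp_apply, LinearMap.comp_apply, ← LinearMap.adjoint_inner_left]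
  have hux' : β * ‖y‖ ^ 2 ≤ RCLike.re ⟪u y, LinearMap.adjoint Q y⟫_𝕜 := by rw [← hadj]; exact hux y
  exact sq_div_mul_le_re_inner_green hTs hpos hMu hβ hux' (huu y)

include hTs in
/-- **`‖(QG₁Q†)⁻¹y‖ ≤ (M_u∕β²)·‖y‖`** from a test family (`β > 0`) — `M`-free. [folklore]
[cite: Balaban1985BackgroundPropagators, Thm 3.11 p.416; Balaban1985Variational, (45) p.285] -/
theorem norm_KinvK_le_of_test {u : F → E} {β Mu : ℝ} (hMu : 0 < Mu) (hβ : 0 < β)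
    (hux : ∀ y : F, β * ‖y‖ ^ 2 ≤ RCLike.re ⟪Q (u y), y⟫_𝕜)
    (huu : ∀ y : F, RCLike.re ⟪u y, laplaceAK Δ D R Dstar Q (LinearMap.adjoint Q) a (u y)⟫_𝕜 ≤ Mu * ‖y‖ ^ 2) (y : F) :
    ‖KinvK hpos hadj hinj y‖ ≤ Mu / β ^ 2 * ‖y‖ := by
  have h := norm_greenK_le (T := Q ∘ₗ G1K Δ D R Dstar Q (LinearMap.adjoint Q) a hpos ∘ₗ LinearMap.adjoint Q) (γ := β ^ 2 / Mu)
    (by positivity) (re_inner_K_ge_of_test hpos hadj hTs hMu hβ.le hux huu) (B11Eq103H1Complex.re_inner_KK_pos hpos hadj hinj) y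
  rw [inv_div] at h
  exact h

include hγ hcoer hTs in
/-- **`‖H₁b‖ ≤ √(M_u∕(γβ²))·‖b‖`** from the coercivity constant `γ` of `Δ_a` and a test family — THE `M`-FREE `H₁` LETTER. [folklore]
[cite: Balaban1985Variational, (45)–(46) p.285; Balaban1985BackgroundPropagators, (3.126) p.420, Thm 3.11 p.416] -/
theorem norm_H1K_le_of_test {u : F → E} {β Mu : ℝ} (hMu : 0 < Mu) (hβ : 0 < β)
    (hux : ∀ y : F, β * ‖y‖ ^ 2 ≤ RCLike.re ⟪Q (u y), y⟫_𝕜)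
    (huu : ∀ y : F, RCLike.re ⟪u y, laplaceAK Δ D R Dstar Q (LinearMap.adjoint Q) a (u y)⟫_𝕜 ≤ Mu * ‖y‖ ^ 2) (b : F) :
    ‖H1K hpos hadj hinj b‖ ≤ Real.sqrt (Mu / (γ * β ^ 2)) * ‖b‖ := by
  have h := norm_H1K_le_of_KinvK hpos hadj hinj hγ hcoer (CK := Mu / β ^ 2) (by positivity)
    (norm_KinvK_le_of_test hpos hadj hinj hTs hMu hβ hux huu) b
  rwa [div_div, mul_comm (β ^ 2) γ] at h

include hadj hTs in
/-- **THE SECTION CASE**: a right inverse `S` of `Q` (`QSy = y`) with energy `re⟪Sy, Δ_a Sy⟫ ≤ C_S‖y‖²` (`C_S > 0`) gives `C_S⁻¹‖y‖² ≤ re⟪y, QG₁Q†y⟫`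
(the test family `u = S`, `β = 1`). [folklore] [cite: Balaban1985BackgroundPropagators, Thm 3.11 p.416, (3.19) p.393; Balaban1985Variational, (45) p.285] -/
theorem re_inner_K_ge_of_section {Sx : F →ₗ[𝕜] E} (hS : ∀ y : F, Q (Sx y) = y) {CS : ℝ} (hCS : 0 < CS)
    (hSe : ∀ y : F, RCLike.re ⟪Sx y, laplaceAK Δ D R Dstar Q (LinearMap.adjoint Q) a (Sx y)⟫_𝕜 ≤ CS * ‖y‖ ^ 2) (y : F) :
    CS⁻¹ * ‖y‖ ^ 2 ≤ RCLike.re ⟪y, (Q ∘ₗ G1K Δ D R Dstar Q (LinearMap.adjoint Q) a hpos ∘ₗ LinearMap.adjoint Q) y⟫_𝕜 := by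
  have h := re_inner_K_ge_of_test hpos hadj hTs (u := fun y => Sx y) (β := 1) hCS zero_le_one
    (fun y => by rw [hS, inner_self_eq_norm_sq, one_mul]) hSe y
  rwa [one_pow, one_div] at h

include hTs in
/-- `‖(QG₁Q†)⁻¹y‖ ≤ C_S·‖y‖` from a section of energy `C_S`. [folklore] [cite: Balaban1985BackgroundPropagators, Thm 3.11 p.416; Balaban1985Variational, (45) p.285] -/
theorem norm_KinvK_le_of_section {Sx : F →ₗ[𝕜] E} (hS : ∀ y : F, Q (Sx y) = y) {CS : ℝ} (hCS : 0 < CS)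
    (hSe : ∀ y : F, RCLike.re ⟪Sx y, laplaceAK Δ D R Dstar Q (LinearMap.adjoint Q) a (Sx y)⟫_𝕜 ≤ CS * ‖y‖ ^ 2) (y : F) :
    ‖KinvK hpos hadj hinj y‖ ≤ CS * ‖y‖ := by
  have h := norm_KinvK_le_of_test hpos hadj hinj hTs (u := fun y => Sx y) (β := 1) hCS zero_lt_one
    (fun y => by rw [hS, inner_self_eq_norm_sq, one_mul]) hSe y
  rwa [one_pow, div_one] at h

include hγ hcoer hTs in
/-- **`‖H₁b‖ ≤ √(C_S∕γ)·‖b‖`** from the coercivity constant `γ` and a section of energy `C_S` — `M`-free. [folklore]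
[cite: Balaban1985Variational, (45)–(46) p.285; Balaban1985BackgroundPropagators, (3.126) p.420, Thm 3.11 p.416] -/
theorem norm_H1K_le_of_section {Sx : F →ₗ[𝕜] E} (hS : ∀ y : F, Q (Sx y) = y) {CS : ℝ} (hCS : 0 < CS)
    (hSe : ∀ y : F, RCLike.re ⟪Sx y, laplaceAK Δ D R Dstar Q (LinearMap.adjoint Q) a (Sx y)⟫_𝕜 ≤ CS * ‖y‖ ^ 2) (b : F) :
    ‖H1K hpos hadj hinj b‖ ≤ Real.sqrt (CS / γ) * ‖b‖ :=
  norm_H1K_le_of_KinvK hpos hadj hinj hγ hcoer hCS.le (norm_KinvK_le_of_section hpos hadj hinj hTs hS hCS hSe) b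

/-! ## §4 (45): `H₁b` minimises the energy on `{Qx₀ = b}` (symmetric `Δ_a`) -/

include hTs in
/-- **ENERGY SPLITTING on the constraint**: for `Qx₀ = b`, `re⟪x₀, Δ_a x₀⟫ = re⟪H₁b, Δ_a H₁b⟫ + re⟪x₀ − H₁b, Δ_a(x₀ − H₁b)⟫` — the cross terms vanish
because `Δ_a H₁b ∈ range Q†` is orthogonal to `ker Q ∋ x₀ − H₁b` (`B11Eq103H1Complex.inner_laplaceAK_H1K_eq_zero`, [B11] p. 293 «⟨δA′, Δ₁H₁B⟩ = 0») and
`Δ_a` is symmetric; complex twin of lit-balaban's `B11Eq129Minimizer.energy_split`. [folklore] [cite: Balaban1985Variational, (45) p.285, p.293, (129) p.297] -/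
theorem re_inner_laplaceAK_H1K_add {x₀ : E} {b : F} (hx₀ : Q x₀ = b) :
    RCLike.re ⟪x₀, laplaceAK Δ D R Dstar Q (LinearMap.adjoint Q) a x₀⟫_𝕜 =
      RCLike.re ⟪H1K hpos hadj hinj b, laplaceAK Δ D R Dstar Q (LinearMap.adjoint Q) a (H1K hpos hadj hinj b)⟫_𝕜 +
        RCLike.re ⟪x₀ - H1K hpos hadj hinj b, laplaceAK Δ D R Dstar Q (LinearMap.adjoint Q) a (x₀ - H1K hpos hadj hinj b)⟫_𝕜 := by
  set T := laplaceAK Δ D R Dstar Q (LinearMap.adjoint Q) a with hT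
  set h := H1K hpos hadj hinj b with hh
  set δ := x₀ - h with hδ
  have hQδ : Q δ = 0 := by rw [hδ, map_sub, hx₀, hh, Q_H1K, sub_self]
  have h1 : ⟪δ, T h⟫_𝕜 = 0 := inner_laplaceAK_H1K_eq_zero hpos hadj hinj b hQδ
  have h2 : ⟪h, T δ⟫_𝕜 = 0 := by rw [← hTs h δ, ← inner_conj_symm, h1, map_zero]
  have hx : x₀ = h + δ := by rw [hδ]; abel
  rw [hx, map_add, inner_add_left, inner_add_right, inner_add_right, h1, h2, add_zero, zero_add, map_add]

include hTs in
/-- **(45)∕(129): `H₁b` MINIMISES `re⟪x₀, Δ_a x₀⟫` ON `{Qx₀ = b}`** (the defect's energy is `≥ 0` by the displayed positivity). [folklore]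
[cite: Balaban1985Variational, (45) p.285, (129) p.297] -/
theorem re_inner_laplaceAK_H1K_le {x₀ : E} {b : F} (hx₀ : Q x₀ = b) :
    RCLike.re ⟪H1K hpos hadj hinj b, laplaceAK Δ D R Dstar Q (LinearMap.adjoint Q) a (H1K hpos hadj hinj b)⟫_𝕜 ≤
      RCLike.re ⟪x₀, laplaceAK Δ D R Dstar Q (LinearMap.adjoint Q) a x₀⟫_𝕜 := by
  rw [re_inner_laplaceAK_H1K_add hpos hadj hinj hTs hx₀]
  have h0 : 0 ≤ RCLike.re ⟪x₀ - H1K hpos hadj hinj b,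
      laplaceAK Δ D R Dstar Q (LinearMap.adjoint Q) a (x₀ - H1K hpos hadj hinj b)⟫_𝕜 := by
    by_cases h : x₀ - H1K hpos hadj hinj b = 0
    · rw [h, inner_zero_left, map_zero]
    · exact (hpos _ h).le
  linarith

include hTs in
/-- **`re⟪b, (QG₁Q†)⁻¹b⟫ ≤ re⟪x₀, Δ_a x₀⟫` for EVERY `x₀` with `Qx₀ = b`** — the `K⁻¹`-form is the minimal energy. [folklore]
[cite: Balaban1985Variational, (45) p.285, (129) p.297; Balaban1985BackgroundPropagators, Thm 3.11 p.416] -/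
theorem re_inner_KinvK_le_energy {x₀ : E} {b : F} (hx₀ : Q x₀ = b) :
    RCLike.re ⟪b, KinvK hpos hadj hinj b⟫_𝕜 ≤ RCLike.re ⟪x₀, laplaceAK Δ D R Dstar Q (LinearMap.adjoint Q) a x₀⟫_𝕜 := by
  rw [← re_inner_H1K_laplaceAK_H1K hpos hadj hinj]
  exact re_inner_laplaceAK_H1K_le hpos hadj hinj hTs hx₀

include hγ hcoer hTs in
/-- **`‖H₁b‖² ≤ γ⁻¹·re⟪x₀, Δ_a x₀⟫` for EVERY comparison configuration `x₀` with `Qx₀ = b`** — the shape in which print bounds `H` ((46) from the energy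
of an explicit configuration and [B9] Thm 3.12); `M`-free. [folklore] [cite: Balaban1985Variational, (45)–(46) p.285; Balaban1985BackgroundPropagators, (3.126) p.420] -/
theorem norm_H1K_sq_le_energy {x₀ : E} {b : F} (hx₀ : Q x₀ = b) :
    ‖H1K hpos hadj hinj b‖ ^ 2 ≤ γ⁻¹ * RCLike.re ⟪x₀, laplaceAK Δ D R Dstar Q (LinearMap.adjoint Q) a x₀⟫_𝕜 :=
  (norm_H1K_sq_le hpos hadj hinj hγ hcoer b).trans
    (mul_le_mul_of_nonneg_left (re_inner_KinvK_le_energy hpos hadj hinj hTs hx₀) (inv_nonneg.2 hγ.le))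

end Abstract

end Literature.MathematicalPhysics.QuantumFieldTheory.Balaban1983to89.B9Eq3126GreenLettersVariational
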